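import Literature.NumberTheory.DiophantineApproximation.PolylogShiftHermitePadeExpansion
import Literature.NumberTheory.DiophantineApproximation.PolylogShiftHermitePadeSeries
import Literature.NumberTheory.DiophantineApproximation.PolylogShiftHermitePadeForms
import Literature.NumberTheory.DiophantineApproximation.PolylogShiftHermitePadeBounds
import Literature.NumberTheory.DiophantineApproximation.PolylogShiftLeadingRate
import Literature.NumberTheory.DiophantineApproximation.PolylogTwoPointLinearIndependence
import HarnessLib

/-!
# Linear independence of `1` and the shifted polylogarithms `Φ_{s,r}(1/M)` (`r ≤ m`, `s ≤ w`) for `log M ≥ 4m³(w+1)³`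

Topic `Literature/NumberTheory/DiophantineApproximation`. For all integers `m ≥ 2`, `w ≥ 1` and every integer `M`
with `log M ≥ 4 m³ (w + 1)³`, the `mw + 1` real numbers `1` and
`Φ_{s,r}(1/M) = ∑_{k≥0} M^{-k-1}/(mk+r)^s` (`1 ≤ r ≤ m`, `1 ≤ s ≤ w`; `ShiftPade.lerchShift m r s (1/M)`) are linearly
independent over `ℚ` (`ShiftPade.intRelation_trivial_shift`, integer coefficients; `one_lerchShift_linearIndependent`,
rational coefficients) — the distinct-shifts (Lerch) form of the Nikišin–Hata–David–Hirata-Kohno–Kawashima theorem with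
the shifts `r/m`, proved with a crude threshold; `m = 2` is `PolylogTwoPointLinearIndependence.lean`, and `m = 4` controls
`1, Li_s(1/N), Li_s(−1/N), Li_s(−1/N²)` (`PolylogShiftFourBridge.lean`).
-- TODO(general form): algebraic points and the effective thresholds of the distinct-shifts paper (arXiv:2010.09167).

## Proof (assembled from the sibling files)

Exactly as in the parity case: the kernel `K(u) = m^{2wn}(u − wn + 1)_{wn}/(mu+1)_{n+1}^w` expands over the Ball–Rivoal
bricks (`exists_pf_kernelM`; `d_n^{w−1−o} c_{o,p} ∈ ℤ`, `∑|c| ≤ w!·m^{2nw}·2^{w((mw+3)n+1)}`), the form satisfies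
`Λ_n(1/M) = ∑_{o,r} a_{o,r} Φ_{o+1,r+1}(1/M) + a` (`formM_eq_of_pfEval`) with `d_n^w a_{o,r}, d_n^w a ∈ ℤ` and
`|a_{o,r}| ≤ (∑|c|) M^{n/m}` (Forms), and `K(wn) M^{−wn−1} ≤ Λ_n ≤ (m²/M)^{wn}` (Bounds), `K(wn) ≥ e^{−(κ+ε)n}` with
`κ = κ_m(w) = w((mw+1) log(1+1/(mw)) − log m)` (LeadingRate). The INTEGER forms `d_n^w Λ_n(1/M)` in the `mw` numbers have rates
`A₂ = w log M − 2w log m − w − ε`, `A₁ = w log M + κ + ε`, `B = (log M)/m + 2w log m + w(mw+3) log 2 + w + ε`; the ratio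
`w : 1/m` of smallness to height closes Nesterenko's two-rate criterion (`relation_trivial_of_small_forms` + `no_integer_forms`
in dimension `mw − 1`) as soon as `(log M)/m` beats an explicit cubic in `w` with coefficients `O(m²)`, which
`log M ≥ 4 m³ (w+1)³` guarantees (`gap_inequalities_shift`).

References: S. David, N. Hirata-Kohno, M. Kawashima, Moscow J. Comb. Number Th. 9 (2020), Thm 2.1, and *Linear independence
criteria for generalized polylogarithms with distinct shifts*, arXiv:2010.09167; E. M. Nikišin, Mat. Sb. 109 (1979); M. Hata,
J. Math. Pures Appl. 69 (1990); Yu. V. Nesterenko, Vestnik MGU (1985) (the criterion).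
-/

noncomputable section

open Finset Filter Real

namespace Literature.NumberTheory.DiophantineApproximation

namespace ShiftPade

open _root_.Filter _root_.Topology
open Literature.NumberTheory.Transcendental

/-- The numerical heart of the threshold `log M ≥ 4 m³ (w+1)³`: with `−w·log m ≤ κ ≤ w + 1`, `0 ≤ log m ≤ m`,
`0 ≤ l2 ≤ 0.7` and `c_B = 2 w log m + w(mw+3) l2` the gap conditions of the reduction/transference lemmas hold in
dimension `mw − 1` for the rates `A₁ = wL + κ + 2δ`, `A₂ = wL − 2w log m − w − 2δ`, `B = L/m + c_B + w + 2δ`,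
`δ = 1/8` (and `A₂ ≤ A₁`, `0 ≤ B`). [folklore] -/
theorem gap_inequalities_shift {mr wr L κ cB lm l2 δ : ℝ} (hmr : 2 ≤ mr) (hwr1 : 1 ≤ wr) (hδ : δ = 1 / 8)
    (hκ0 : -(wr * lm) ≤ κ) (hκ1 : κ ≤ wr + 1) (hlm0 : 0 ≤ lm) (hlm1 : lm ≤ mr)
    (hl20 : 0 ≤ l2) (hl21 : l2 ≤ 7 / 10) (hcB : cB = 2 * wr * lm + wr * (mr * wr + 3) * l2)
    (hL : 4 * mr ^ 3 * (wr + 1) ^ 3 ≤ L) :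
    0 < wr * L - 2 * wr * lm - wr - 2 * δ ∧
      (mr * wr - 1) * (L / mr + cB + wr + 2 * δ) < wr * L - 2 * wr * lm - wr - 2 * δ ∧
        (mr * wr - 1) * ((wr * L + κ + 2 * δ) + (L / mr + cB + wr + 2 * δ)) <
          (mr * wr - 1 + 1) * (wr * L - 2 * wr * lm - wr - 2 * δ) ∧
          wr * L - 2 * wr * lm - wr - 2 * δ ≤ wr * L + κ + 2 * δ ∧
            0 ≤ L / mr + cB + wr + 2 * δ := by
  subst hδ
  have hmr0 : 0 < mr := by linarith only [hmr]
  have hwr0 : 0 < wr := by linarith only [hwr1]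
  obtain ⟨P, hP⟩ : ∃ P : ℝ, P = mr * wr := ⟨_, rfl⟩
  have hP2 : 2 ≤ P := by
    have h := mul_le_mul hmr hwr1 zero_le_one hmr0.le
    rw [hP]; linarith only [h]
  have hP1 : 0 ≤ P - 1 := by linarith only [hP2]
  have hwlm : 0 ≤ wr * lm := mul_nonneg hwr0.le hlm0
  have hx : 0 ≤ wr * (mr * wr + 3) * l2 := by positivity
  have hcB0 : 2 * wr * lm ≤ cB := by rw [hcB]; linarith only [hx]
  have hcB1 : cB ≤ 2 * wr * lm + 7 / 10 * wr * (P + 3) := by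
    have h1 : wr * (mr * wr + 3) * l2 ≤ wr * (mr * wr + 3) * (7 / 10) :=
      mul_le_mul_of_nonneg_left hl21 (by positivity)
    rw [hcB, hP]
    linarith only [h1]
  -- the constant of the second condition and its bound
  obtain ⟨S, hS⟩ : ∃ S : ℝ,
      S = (P - 1) * (κ + cB + wr + 4 * (1 / 8)) + P * (2 * wr * lm + wr + 2 * (1 / 8)) := ⟨_, rfl⟩
  have hbr0 : 0 ≤ κ + cB + wr + 4 * (1 / 8) := by linarith only [hκ0, hcB0, hwlm, hwr0]
  have hbr1 : κ + cB + wr + 4 * (1 / 8) ≤ 2 * wr * lm + 7 / 10 * wr * (P + 3) + 2 * wr + 3 / 2 := by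
    linarith only [hκ1, hcB1]
  have hS1 : S ≤ P * (2 * wr * lm + 7 / 10 * wr * (P + 3) + 2 * wr + 3 / 2) +
      P * (2 * wr * lm + wr + 1 / 4) := by
    have e1 : (P - 1) * (κ + cB + wr + 4 * (1 / 8)) =
        P * (κ + cB + wr + 4 * (1 / 8)) - (κ + cB + wr + 4 * (1 / 8)) := by ring
    have h2 : P * (κ + cB + wr + 4 * (1 / 8)) ≤ P * (2 * wr * lm + 7 / 10 * wr * (P + 3) + 2 * wr + 3 / 2) :=
      mul_le_mul_of_nonneg_left hbr1 (by linarith only [hP2])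
    rw [hS, e1]
    linarith only [h2, hbr0]
  have hS2 : S ≤ mr * (mr * (7 / 10 * wr ^ 3 + 4 * wr ^ 2) + (51 / 10 * wr ^ 2 + 7 / 4 * wr)) := by
    have hlmP : P * (4 * wr * lm) ≤ P * (4 * wr * mr) := by
      refine mul_le_mul_of_nonneg_left ?_ (by linarith only [hP2])
      exact mul_le_mul_of_nonneg_left hlm1 (by positivity)
    have e : P * (2 * wr * lm + 7 / 10 * wr * (P + 3) + 2 * wr + 3 / 2) + P * (2 * wr * lm + wr + 1 / 4) =
        7 / 10 * wr * P ^ 2 + P * (4 * wr * lm) + P * (51 / 10 * wr + 7 / 4) := by ring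
    have e2 : mr * (mr * (7 / 10 * wr ^ 3 + 4 * wr ^ 2) + (51 / 10 * wr ^ 2 + 7 / 4 * wr)) =
        7 / 10 * wr * P ^ 2 + P * (4 * wr * mr) + P * (51 / 10 * wr + 7 / 4) := by rw [hP]; ring
    linarith only [hS1, hlmP, e, e2]
  have hLm : 4 * mr ^ 2 * (wr + 1) ^ 3 ≤ L / mr := by
    rw [le_div_iff₀ hmr0]
    have e : 4 * mr ^ 2 * (wr + 1) ^ 3 * mr = 4 * mr ^ 3 * (wr + 1) ^ 3 := by ring
    rw [e]
    exact hL
  have hSL : S < L / mr := by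
    have hq : 0 ≤ 51 / 20 * wr ^ 2 + 7 / 8 * wr := by positivity
    have h4 : 2 * (51 / 20 * wr ^ 2 + 7 / 8 * wr) ≤ mr * (51 / 20 * wr ^ 2 + 7 / 8 * wr) :=
      mul_le_mul_of_nonneg_right hmr hq
    have h5 : mr * (mr * (7 / 10 * wr ^ 3 + 4 * wr ^ 2) + (51 / 10 * wr ^ 2 + 7 / 4 * wr)) ≤
        mr * (mr * (7 / 10 * wr ^ 3 + 4 * wr ^ 2) + mr * (51 / 20 * wr ^ 2 + 7 / 8 * wr)) :=
      mul_le_mul_of_nonneg_left (by linarith only [h4]) hmr0.le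
    have h6 : mr * (mr * (7 / 10 * wr ^ 3 + 4 * wr ^ 2) + mr * (51 / 20 * wr ^ 2 + 7 / 8 * wr)) =
        mr ^ 2 * (7 / 10 * wr ^ 3 + 131 / 20 * wr ^ 2 + 7 / 8 * wr) := by ring
    have h7 : 7 / 10 * wr ^ 3 + 131 / 20 * wr ^ 2 + 7 / 8 * wr < 4 * (wr + 1) ^ 3 := by
      have e7 : 4 * (wr + 1) ^ 3 - (7 / 10 * wr ^ 3 + 131 / 20 * wr ^ 2 + 7 / 8 * wr) =
          33 / 10 * wr ^ 3 + 109 / 20 * wr ^ 2 + 89 / 8 * wr + 4 := by ring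
      have h77 : 0 < 33 / 10 * wr ^ 3 + 109 / 20 * wr ^ 2 + 89 / 8 * wr + 4 := by positivity
      linarith only [e7, h77]
    have h8 : mr ^ 2 * (7 / 10 * wr ^ 3 + 131 / 20 * wr ^ 2 + 7 / 8 * wr) < mr ^ 2 * (4 * (wr + 1) ^ 3) :=
      mul_lt_mul_of_pos_left h7 (by positivity)
    have h9 : mr ^ 2 * (4 * (wr + 1) ^ 3) = 4 * mr ^ 2 * (wr + 1) ^ 3 := by ring
    rw [h6] at h5
    linarith only [hS2, h5, h8, h9, hLm]
  -- the algebraic identities behind g1, g2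
  have e2 : (mr * wr - 1 + 1) * (wr * L - 2 * wr * lm - wr - 2 * (1 / 8)) -
      (mr * wr - 1) * ((wr * L + κ + 2 * (1 / 8)) + (L / mr + cB + wr + 2 * (1 / 8))) = L / mr - S := by
    rw [hS, hP]; field_simp; ring
  have e1 : (wr * L - 2 * wr * lm - wr - 2 * (1 / 8)) - (mr * wr - 1) * (L / mr + cB + wr + 2 * (1 / 8)) =
      L / mr - S + (P - 1) * (κ + 2 * wr * lm + wr + 4 * (1 / 8)) := by
    rw [hS, hP]; field_simp; ring
  have hpos1 : 0 ≤ (P - 1) * (κ + 2 * wr * lm + wr + 4 * (1 / 8)) :=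
    mul_nonneg hP1 (by linarith only [hκ0, hwlm, hwr0])
  -- g0
  have hc : 2 * mr + 2 ≤ 32 * mr ^ 3 := by
    have h1 : 2 * 2 ≤ mr * mr := mul_le_mul hmr hmr (by norm_num) hmr0.le
    have h2 : mr * 4 ≤ mr * (mr * mr) := mul_le_mul_of_nonneg_left (by linarith only [h1]) hmr0.le
    have e : mr ^ 3 = mr * (mr * mr) := by ring
    rw [e]
    linarith only [h2, hmr]
  have hLb : 32 * mr ^ 3 ≤ L := by
    have h8' : (2 : ℝ) ^ 3 ≤ (wr + 1) ^ 3 :=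
      pow_le_pow_left₀ (by norm_num) (by linarith only [hwr1] : (2 : ℝ) ≤ wr + 1) 3
    have h := mul_le_mul_of_nonneg_left h8' (show (0 : ℝ) ≤ 4 * mr ^ 3 by positivity)
    norm_num at h
    linarith only [h, hL]
  have ha : wr * (32 * mr ^ 3) ≤ wr * L := mul_le_mul_of_nonneg_left hLb hwr0.le
  have hb : wr * lm ≤ wr * mr := mul_le_mul_of_nonneg_left hlm1 hwr0.le
  have hd : wr * (2 * mr + 2) ≤ wr * (32 * mr ^ 3) := mul_le_mul_of_nonneg_left hc hwr0.le
  have hLpos : 0 ≤ L / mr := by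
    have : 0 ≤ L := by linarith only [hLb, pow_pos hmr0 3]
    positivity
  refine ⟨by linarith only [ha, hb, hd, hwr1], by linarith only [e1, hSL, hpos1],
    by linarith only [e2, hSL], by linarith only [hκ0, hwlm, hwr0], ?_⟩
  linarith only [hLpos, hcB0, hwlm, hwr0]


/-- **No integer relation among `1` and the `Φ_{s,r}(1/M)` (`r ≤ m`, `s ≤ w`)** for `m ≥ 2`, `w ≥ 1` and
`log M ≥ 4 m³ (w+1)³`: if `a + ∑_{j<w} ∑_{r<m} b_{j,r} Φ_{j+1,r+1}(1/M) = 0` with integers `a, b_{j,r}`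
(`Φ_{s,r} = lerchShift m r s`), then all of them vanish. [cite: DavidHirataKohnoKawashima2020, Thm 2.1] -/
theorem intRelation_trivial_shift (m w : ℕ) (hm : 2 ≤ m) (hw : 1 ≤ w) (M : ℕ)
    (hM : 4 * (m : ℝ) ^ 3 * ((w : ℝ) + 1) ^ 3 ≤ Real.log M)
    (a : ℤ) (b : Fin w → Fin m → ℤ)
    (h : (a : ℝ) + ∑ j : Fin w, ∑ r : Fin m, (b j r : ℝ) *
      lerchShift m ((r : ℕ) + 1) ((j : ℕ) + 1) (1 / (M : ℝ)) = 0) :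
    a = 0 ∧ b = 0 := by
  classical
  obtain ⟨k, rfl⟩ : ∃ k, w = k + 1 := ⟨w - 1, by omega⟩
  have hm1 : 1 ≤ m := le_trans (by norm_num) hm
  -- `M ≥ 4`, `y = 1/M ∈ (0, 1/2]`
  have hwr : (1 : ℝ) ≤ ((k + 1 : ℕ) : ℝ) := by exact_mod_cast hw
  have hmr2 : (2 : ℝ) ≤ (m : ℝ) := by exact_mod_cast hm
  have hL3 : (64 : ℝ) ≤ Real.log M := by
    have h2 : (2 : ℝ) ^ 3 ≤ (((k + 1 : ℕ) : ℝ) + 1) ^ 3 :=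
      pow_le_pow_left₀ (by norm_num) (by linarith only [hwr]) 3
    have h3 : (2 : ℝ) ^ 3 ≤ (m : ℝ) ^ 3 := pow_le_pow_left₀ (by norm_num) hmr2 3
    have h4 := mul_le_mul h3 h2 (by norm_num) (by positivity)
    have h5 : (2 : ℝ) ^ 3 * 2 ^ 3 = 64 := by norm_num
    linarith only [h4, h5, hM]
  have hM0 : (M : ℝ) ≠ 0 := by
    intro h0; rw [h0, Real.log_zero] at hL3; linarith only [hL3]
  have hMpos : (0 : ℝ) < M := lt_of_le_of_ne (Nat.cast_nonneg M) (Ne.symm hM0)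
  have hM4 : (4 : ℝ) ≤ M := by
    have h1 : Real.log M ≤ (M : ℝ) - 1 := Real.log_le_sub_one_of_pos hMpos
    linarith only [h1, hL3]
  have hM2 : 2 ≤ M := by exact_mod_cast (show (2 : ℝ) ≤ M by linarith only [hM4])
  have hM1 : 1 ≤ M := le_trans (by norm_num) hM2
  have hx0 : (0 : ℝ) < 1 / M := by positivity
  have hx1 : 1 / (M : ℝ) ≤ 1 / 2 := one_div_le_one_div_of_le (by norm_num) (by linarith only [hM4])
  have hx1' : 1 / (M : ℝ) < 1 := by linarith only [hx1]
  -- the constants (opaque, with defining equations)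
  obtain ⟨wr, hwrdef⟩ : ∃ wr : ℝ, wr = ((k + 1 : ℕ) : ℝ) := ⟨_, rfl⟩
  obtain ⟨mr, hmrdef⟩ : ∃ mr : ℝ, mr = (m : ℝ) := ⟨_, rfl⟩
  obtain ⟨l2, hl2def⟩ : ∃ l2 : ℝ, l2 = Real.log 2 := ⟨_, rfl⟩
  obtain ⟨lm, hlmdef⟩ : ∃ lm : ℝ, lm = Real.log m := ⟨_, rfl⟩
  obtain ⟨L, hLdef⟩ : ∃ L : ℝ, L = Real.log M := ⟨_, rfl⟩
  obtain ⟨κ, hκdef⟩ : ∃ κ : ℝ,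
      κ = wr * ((mr * wr + 1) * Real.log ((mr * wr + 1) / (mr * wr)) - lm) := ⟨_, rfl⟩
  obtain ⟨cB, hcBdef⟩ : ∃ cB : ℝ, cB = 2 * wr * lm + wr * (mr * wr + 3) * l2 := ⟨_, rfl⟩
  obtain ⟨δ, hδdef⟩ : ∃ δ : ℝ, δ = 1 / 8 := ⟨_, rfl⟩
  have hwr1 : 1 ≤ wr := by rw [hwrdef]; exact hwr
  have hwrk : wr = (k : ℝ) + 1 := by rw [hwrdef]; push_cast; ring
  have hmr : 2 ≤ mr := by rw [hmrdef]; exact hmr2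
  have hwrpos : 0 < wr := by linarith only [hwr1]
  have hmrpos : 0 < mr := by linarith only [hmr]
  have hδ : (0 : ℝ) < δ := by rw [hδdef]; norm_num
  have hl20 : 0 ≤ l2 := by rw [hl2def]; exact Real.log_nonneg (by norm_num)
  have hl21 : l2 ≤ 7 / 10 := by
    rw [hl2def]
    have h1 := Real.log_two_lt_d9
    norm_num at h1 ⊢
    linarith only [h1]
  have hlm0 : 0 ≤ lm := by rw [hlmdef]; exact Real.log_nonneg (by linarith only [hmr2])
  have hlm1 : lm ≤ mr := by
    rw [hlmdef, hmrdef]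
    have h1 := Real.log_le_sub_one_of_pos (show (0:ℝ) < m by linarith only [hmr2])
    linarith only [h1]
  have hL : 4 * mr ^ 3 * (wr + 1) ^ 3 ≤ L := by rw [hLdef, hwrdef, hmrdef]; exact hM
  -- `−w log m ≤ κ ≤ w + 1` from `1 ≤ (P+1) log(1 + 1/P) ≤ 1 + 1/P`, `P = m w`
  have hPpos : 0 < mr * wr := mul_pos hmrpos hwrpos
  have hratio : (mr * wr + 1) / (mr * wr) = 1 + 1 / (mr * wr) := by field_simp
  have hlog_le : Real.log ((mr * wr + 1) / (mr * wr)) ≤ 1 / (mr * wr) := by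
    have h1 := Real.log_le_sub_one_of_pos (show (0 : ℝ) < (mr * wr + 1) / (mr * wr) by positivity)
    rw [hratio] at h1 ⊢
    linarith only [h1]
  have hlog_ge : 1 / (mr * wr + 1) ≤ Real.log ((mr * wr + 1) / (mr * wr)) := by
    have hpos : (0 : ℝ) < (mr * wr + 1) / (mr * wr) := by positivity
    have h1 : 1 - ((mr * wr + 1) / (mr * wr))⁻¹ ≤ Real.log ((mr * wr + 1) / (mr * wr)) :=
      Real.one_sub_inv_le_log_of_pos hpos
    have h2 : 1 - ((mr * wr + 1) / (mr * wr))⁻¹ = 1 / (mr * wr + 1) := by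
      field_simp
      ring
    rw [h2] at h1
    exact h1
  have hκ0 : -(wr * lm) ≤ κ := by
    have e : (mr * wr + 1) * (1 / (mr * wr + 1)) = 1 := by field_simp
    have hh := mul_le_mul_of_nonneg_left hlog_ge (show (0:ℝ) ≤ mr * wr + 1 by positivity)
    rw [e] at hh
    have h3 : wr * (1 - lm) ≤ κ := by
      rw [hκdef]
      exact mul_le_mul_of_nonneg_left (by linarith only [hh]) hwrpos.le
    have e2 : wr * (1 - lm) = wr - wr * lm := by ring
    linarith only [h3, e2, hwrpos]
  have hκ1 : κ ≤ wr + 1 := by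
    have h1 : (mr * wr + 1) * Real.log ((mr * wr + 1) / (mr * wr)) ≤ (mr * wr + 1) * (1 / (mr * wr)) :=
      mul_le_mul_of_nonneg_left hlog_le (by positivity)
    have h2 : (mr * wr + 1) * (1 / (mr * wr)) = 1 + 1 / (mr * wr) := by field_simp
    have h3 : κ ≤ wr * (1 + 1 / (mr * wr) - lm) := by
      rw [hκdef]
      refine mul_le_mul_of_nonneg_left ?_ hwrpos.le
      linarith only [h1, h2]
    have e3 : wr * (1 + 1 / (mr * wr) - lm) = wr + 1 / mr - wr * lm := by field_simp
    have h4 : 1 / mr ≤ 1 := by rw [div_le_one hmrpos]; linarith only [hmr]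
    have h5 : 0 ≤ wr * lm := mul_nonneg hwrpos.le hlm0
    linarith only [h3, e3, h4, h5]
  have hLpos : 0 < L := by
    have h3 := pow_pos (show (0:ℝ) < wr + 1 by linarith only [hwr1]) 3
    have h4 := pow_pos hmrpos 3
    have := mul_pos (mul_pos (by norm_num : (0:ℝ) < 4) h4) h3
    linarith only [hL, this]
  -- powers as exponentials
  have hxpow : ∀ n : ℕ, (1 / (M : ℝ)) ^ n = Real.exp (-(L * n)) := fun n => by
    rw [hLdef]; exact DilogPade.one_div_pow_eq_exp hMpos n
  have hMpow : ∀ n : ℕ, (M : ℝ) ^ n = Real.exp (L * n) := fun n => by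
    rw [hLdef]; exact DilogPade.pow_eq_exp_log_mul hMpos n
  have h2pow : ∀ n : ℕ, (2 : ℝ) ^ n = Real.exp (l2 * n) := fun n => by
    rw [hl2def]; exact DilogPade.pow_eq_exp_log_mul two_pos n
  have hmpow : ∀ n : ℕ, (m : ℝ) ^ n = Real.exp (lm * n) := fun n => by
    rw [hlmdef]; exact DilogPade.pow_eq_exp_log_mul (by linarith only [hmr2]) n
  -- the gap inequalities
  obtain ⟨g0, g1, g2, gA, gB⟩ :=
    gap_inequalities_shift hmr hwr1 hδdef hκ0 hκ1 hlm0 hlm1 hl20 hl21 hcBdef hL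
  -- the dimension `K + 1 = w·m`
  obtain ⟨K, hK⟩ : ∃ K : ℕ, (k + 1) * m = K + 1 := by
    have h1 : 1 ≤ (k + 1) * m := Nat.one_le_iff_ne_zero.mpr (Nat.mul_ne_zero (by omega) (by omega))
    exact ⟨(k + 1) * m - 1, (Nat.sub_add_cancel h1).symm⟩
  have hkk : ((K : ℕ) : ℝ) = mr * wr - 1 := by
    have e := congrArg (fun t : ℕ => (t : ℝ)) hK
    push_cast at e
    rw [hwrk, hmrdef]
    linarith only [e]
  set e : Fin (K + 1) ≃ Fin (k + 1) × Fin m := (finCongr hK.symm).trans finProdFinEquiv.symm with he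
  -- the numbers `θ`
  set Φv : Fin (k + 1) → Fin m → ℝ := fun j r =>
    lerchShift m ((r : ℕ) + 1) ((j : ℕ) + 1) (1 / (M : ℝ)) with hΦv
  set θ : Fin (K + 1) → ℝ := fun i => Φv (e i).1 (e i).2 with hθ
  have hsumθ : ∀ g : Fin (k + 1) → Fin m → ℝ,
      ∑ i : Fin (K + 1), g (e i).1 (e i).2 * θ i = ∑ j : Fin (k + 1), ∑ r : Fin m, g j r * Φv j r := by
    intro g
    rw [← Fintype.sum_prod_type']
    exact e.sum_comp (fun x : Fin (k + 1) × Fin m => g x.1 x.2 * Φv x.1 x.2)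
  -- the relation, on `θ`
  set cc : Fin (K + 1 + 1) → ℤ := Fin.cons a (fun i => b (e i).1 (e i).2) with hcc
  have h' : (cc 0 : ℝ) + ∑ i : Fin (K + 1), (cc i.succ : ℝ) * θ i = 0 := by
    have e1 : ∑ i : Fin (K + 1), (cc i.succ : ℝ) * θ i = ∑ j : Fin (k + 1), ∑ r : Fin m, (b j r : ℝ) * Φv j r := by
      simp only [hcc, Fin.cons_succ]
      exact hsumθ (fun j r => (b j r : ℝ))
    rw [e1]
    simpa [hcc, hΦv] using h
  -- the partial-fraction data of the kernels, and the integer forms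
  choose cf hcf using fun n => exists_pf_kernelM m (k + 1) n hm1 hw
  have hev : ∀ n (u : ℕ), kernelM m (k + 1) n u = BallRivoal.pfEval n (k + 1) (cf n) (m * u) := by
    intro n u
    refine ((hcf n).1 u fun μ _ => ?_).symm
    have : (0 : ℚ) < (m : ℚ) * (u : ℚ) + μ + 1 := by positivity
    exact this.ne'
  have hint : ∀ n, BallRivoal.IsInt (k + 1) (Nat.lcmUpto n) (cf n) := fun n => (hcf n).2.1
  have hl1 : ∀ n, BallRivoal.l1 n (k + 1) (cf n) ≤ ((k + 1).factorial : ℚ) *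
      ∏ s ∈ range (k + 1), ((m : ℚ) ^ (2 * n) * 2 ^ ((m * s + 3) * n + 1)) := fun n => (hcf n).2.2
  choose qq hqq using fun n (j : Fin (k + 1)) (r : Fin m) =>
    isInt_lcmUpto_pow_mul_coefM (hint n) M (j : ℕ) ((r : ℕ) + 1) j.isLt
  choose p hp using fun n => isInt_lcmUpto_pow_mul_constShift hm1 (hint n) hM1 (w := k + 1)
  set q : ℕ → Fin (K + 1) → ℤ := fun n i => qq n (e i).1 (e i).2 with hq
  set D : ℕ → ℝ := fun n => ((Nat.lcmUpto n : ℝ)) ^ (k + 1) with hD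
  have hDpos : ∀ n, 0 < D n := fun n => by
    simp only [hD]; exact pow_pos (by exact_mod_cast Nat.lcmUpto_pos n) _
  have hD1 : ∀ n, 1 ≤ D n := fun n => by
    simp only [hD]; exact one_le_pow₀ (by exact_mod_cast Nat.lcmUpto_pos n)
  have hqqR : ∀ n (j : Fin (k + 1)) (r : Fin m),
      (qq n j r : ℝ) = D n * ((coefM n m (cf n) M j ((r : ℕ) + 1) : ℚ) : ℝ) := by
    intro n j r
    have h1 := congrArg (fun t : ℚ => (t : ℝ)) (hqq n j r)
    push_cast at h1
    simp only [hD]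
    linear_combination (-1 : ℝ) * h1
  have hpR : ∀ n, (p n : ℝ) = D n * ((constShift n m (k + 1) (cf n) M : ℚ) : ℝ) := by
    intro n
    have h1 := congrArg (fun t : ℚ => (t : ℝ)) (hp n)
    push_cast at h1
    simp only [hD]
    linear_combination (-1 : ℝ) * h1
  -- the value of the forms: `p_n + ∑ q_{n,i} θ_i = D_n · Λ_n(1/M)`
  have hval : ∀ n, (p n : ℝ) + ∑ i, (q n i : ℝ) * θ i = D n * formM m (k + 1) n (1 / (M : ℝ)) := by
    intro n
    have e1 : ∑ i : Fin (K + 1), (q n i : ℝ) * θ i =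
        ∑ j : Fin (k + 1), ∑ r : Fin m, (qq n j r : ℝ) * Φv j r := by
      simp only [hq]
      exact hsumθ (fun j r => (qq n j r : ℝ))
    rw [e1, formM_eq_of_pfEval hm1 hM2 (cf n) (hev n), hpR, mul_add, Finset.mul_sum, Finset.sum_range]
    have e2 : ∀ j : Fin (k + 1), D n * ∑ r ∈ range m, ((coefM n m (cf n) M j (r + 1) : ℚ) : ℝ) *
        lerchShift m (r + 1) (j + 1) (1 / (M : ℝ)) = ∑ r : Fin m, (qq n j r : ℝ) * Φv j r := by
      intro j
      rw [Finset.mul_sum, Finset.sum_range]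
      refine Finset.sum_congr rfl fun r _ => ?_
      rw [hqqR n j r]
      simp only [hΦv]
      ring
    rw [Finset.sum_congr rfl fun j _ => e2 j]
    ring
  have hform_pos : ∀ n, 0 < formM m (k + 1) n (1 / (M : ℝ)) := fun n => formM_pos _ _ n hm1 hx0 hx1'
  have hℓpos : ∀ n, 0 < D n * formM m (k + 1) n (1 / (M : ℝ)) := fun n => mul_pos (hDpos n) (hform_pos n)
  -- `M^{n/m} ≤ exp((L/m) n)` (natural division)
  have hMdiv : ∀ n : ℕ, (M : ℝ) ^ (n / m) ≤ Real.exp (L / mr * n) := fun n => by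
    rw [hMpow]
    apply Real.exp_le_exp.2
    have h6 : ((n / m : ℕ) : ℝ) * mr ≤ n := by
      rw [hmrdef]; exact_mod_cast Nat.div_mul_le_self n m
    have h7 : ((n / m : ℕ) : ℝ) ≤ (n : ℝ) / mr := by rw [le_div_iff₀ hmrpos]; exact h6
    have h8 := mul_le_mul_of_nonneg_left h7 hLpos.le
    have e8 : L * ((n : ℝ) / mr) = L / mr * n := by ring
    linarith only [h8, e8]
  -- apply the reduction + transference in dimension `K = mw − 1`
  have key := relation_trivial_of_small_forms (k := K)
    (fun ξ A₁ A₂ B h1 h2 h3 h4 h5 P Q hl hu hQ => no_integer_forms ξ h1 h2 h3 h4 h5 P Q hl hu hQ)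
    θ (A₁ := wr * L + κ + 2 * δ) (A₂ := wr * L - 2 * wr * lm - wr - 2 * δ)
    (B := L / mr + cB + wr + 2 * δ) g0 gA gB (by rw [hkk]; exact g1)
    (by rw [hkk]; exact g2) p q ?_ ?_ ?_ cc h'
  · -- read off `a = 0`, `b = 0` from `cc = 0`
    have hcc0 : cc = 0 := key
    refine ⟨?_, ?_⟩
    · have := congrFun hcc0 0
      simpa [hcc] using this
    · funext j r
      have := congrFun hcc0 (e.symm (j, r)).succ
      simp only [hcc, Fin.cons_succ, Equiv.apply_symm_apply, Pi.zero_apply] at this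
      simpa using this
  · -- lower bound `e^{-A₁ n} ≤ ℓ_n`
    have hfac' := eventually_exp_le_kernelM_self m (k + 1) hm1 hw hδ
    have hκ' : ((((k + 1 : ℕ) : ℝ)) * (((m : ℝ) * ((k + 1 : ℕ) : ℝ) + 1) *
        Real.log (((m : ℝ) * ((k + 1 : ℕ) : ℝ) + 1) / ((m : ℝ) * ((k + 1 : ℕ) : ℝ))) - Real.log m)) = κ := by
      rw [hκdef, hwrdef, hmrdef, hlmdef]
    filter_upwards [hfac', DilogPade.eventually_const_le_mul L hδ] with n hfac hLn
    rw [hval n, abs_of_pos (hℓpos n)]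
    have hfac2 : Real.exp (-((κ + δ) * n)) ≤
        (m : ℝ) ^ (2 * ((k + 1) * n)) * (((k + 1) * n).factorial : ℝ) *
          (((m * (k + 1) * n).factorial : ℝ) ^ (k + 1)) /
            ((((m * (k + 1) + 1) * n + 1).factorial : ℝ) ^ (k + 1)) := by
      have := hfac
      rw [hκ'] at this
      convert this using 2
    calc Real.exp (-((wr * L + κ + 2 * δ) * n))
        ≤ Real.exp (-((κ + δ) * n)) * Real.exp (-(L * ((((k + 1) * n + 1 : ℕ) : ℝ)))) := by
          rw [← Real.exp_add]
          apply Real.exp_le_exp.2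
          rw [hwrk]
          push_cast
          linear_combination hLn
      _ ≤ (m : ℝ) ^ (2 * ((k + 1) * n)) * (((k + 1) * n).factorial : ℝ) *
            (((m * (k + 1) * n).factorial : ℝ) ^ (k + 1)) /
            ((((m * (k + 1) + 1) * n + 1).factorial : ℝ) ^ (k + 1)) *
            (1 / (M : ℝ)) ^ ((k + 1) * n + 1) := by
          rw [hxpow]
          exact mul_le_mul_of_nonneg_right hfac2 (Real.exp_pos _).le
      _ ≤ formM m (k + 1) n (1 / (M : ℝ)) := formM_ge _ _ n hm1 hx0.le hx1'
      _ ≤ D n * formM m (k + 1) n (1 / (M : ℝ)) := le_mul_of_one_le_left (hform_pos n).le (hD1 n)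
  · -- upper bound `ℓ_n ≤ e^{-A₂ n}`
    have hDev := Literature.NumberTheory.Transcendental.eventually_lcmUpto_mul_pow_le_exp 1 (k + 1) hδ
    filter_upwards [hDev] with n hDn
    rw [one_mul] at hDn
    push_cast at hDn
    rw [hval n, abs_of_pos (hℓpos n)]
    have hform_le : formM m (k + 1) n (1 / (M : ℝ)) ≤
        (m : ℝ) ^ (2 * ((k + 1) * n)) * (1 / (M : ℝ)) ^ ((k + 1) * n) := formM_le _ _ n hm1 hx0.le hx1
    have hDle : D n ≤ Real.exp ((((k : ℝ) + 1) + δ) * n) := by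
      simp only [hD]
      have := hDn
      simp only [one_mul] at this
      exact_mod_cast this
    calc D n * formM m (k + 1) n (1 / (M : ℝ))
        ≤ Real.exp ((((k : ℝ) + 1) + δ) * n) *
            ((m : ℝ) ^ (2 * ((k + 1) * n)) * (1 / (M : ℝ)) ^ ((k + 1) * n)) :=
          mul_le_mul hDle hform_le (hform_pos n).le (Real.exp_pos _).le
      _ = Real.exp (-((wr * L - 2 * wr * lm - wr - 2 * δ) * n) - δ * n) := by
          rw [hmpow, hxpow, ← Real.exp_add, ← Real.exp_add]
          congr 1
          rw [hwrk]
          push_cast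
          ring
      _ ≤ Real.exp (-((wr * L - 2 * wr * lm - wr - 2 * δ) * n)) := by
          apply Real.exp_le_exp.2
          have : 0 ≤ δ * n := by positivity
          linarith only [this]
  · -- coefficients `|q_{n,i}| ≤ e^{B n}`
    have hDev := Literature.NumberTheory.Transcendental.eventually_lcmUpto_mul_pow_le_exp 1 (k + 1) hδ
    filter_upwards [hDev, DilogPade.eventually_const_le_exp_mul
      (((k + 1).factorial : ℝ) * (2 : ℝ) ^ (k + 1)) hδ] with n hDn hfact i
    rw [one_mul] at hDn
    push_cast at hDn
    have hDle : D n ≤ Real.exp ((((k : ℝ) + 1) + δ) * n) := by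
      simp only [hD]
      have := hDn
      simp only [one_mul] at this
      exact_mod_cast this
    -- the `ℓ¹` bound of the partial-fraction data
    have hl1' : BallRivoal.l1 n (k + 1) (cf n) ≤
        ((k + 1).factorial : ℚ) * ((m : ℚ) ^ (2 * n * (k + 1)) * 2 ^ ((k + 1) * ((m * (k + 1) + 3) * n + 1))) :=
      (hl1 n).trans (mul_le_mul_of_nonneg_left (prod_pow_two_pow_le_shiftM m (k + 1) n) (by positivity))
    have hco : |(q n i : ℝ)| ≤ D n * (((k + 1).factorial : ℝ) *
        ((m : ℝ) ^ (2 * n * (k + 1)) * (2 : ℝ) ^ ((k + 1) * ((m * (k + 1) + 3) * n + 1))) * (M : ℝ) ^ (n / m)) := by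
      have hX : |coefM n m (cf n) M ((e i).1 : ℕ) (((e i).2 : ℕ) + 1)| ≤
          BallRivoal.l1 n (k + 1) (cf n) * (M : ℚ) ^ (n / m) := abs_coefM_le (cf n) hM1 (e i).1.isLt _
      have h3 : |coefM n m (cf n) M ((e i).1 : ℕ) (((e i).2 : ℕ) + 1)| ≤
          ((k + 1).factorial : ℚ) * ((m : ℚ) ^ (2 * n * (k + 1)) * 2 ^ ((k + 1) * ((m * (k + 1) + 3) * n + 1))) *
            (M : ℚ) ^ (n / m) := hX.trans (mul_le_mul_of_nonneg_right hl1' (by positivity))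
      have h4 := (Rat.cast_le (K := ℝ)).2 h3
      push_cast at h4
      have eq : (q n i : ℝ) = D n * ((coefM n m (cf n) M ((e i).1 : ℕ) (((e i).2 : ℕ) + 1) : ℚ) : ℝ) := by
        simp only [hq]; exact hqqR n (e i).1 (e i).2
      rw [eq, abs_mul, abs_of_pos (hDpos n)]
      exact mul_le_mul_of_nonneg_left h4 (hDpos n).le
    refine hco.trans ?_
    calc D n * (((k + 1).factorial : ℝ) *
          ((m : ℝ) ^ (2 * n * (k + 1)) * (2 : ℝ) ^ ((k + 1) * ((m * (k + 1) + 3) * n + 1))) * (M : ℝ) ^ (n / m))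
        = D n * ((((k + 1).factorial : ℝ) * (2 : ℝ) ^ (k + 1)) *
            ((m : ℝ) ^ (2 * n * (k + 1)) * (2 : ℝ) ^ ((k + 1) * ((m * (k + 1) + 3) * n)) * (M : ℝ) ^ (n / m))) := by
          rw [show (k + 1) * ((m * (k + 1) + 3) * n + 1) = (k + 1) * ((m * (k + 1) + 3) * n) + (k + 1) by ring,
            pow_add]
          ring
      _ ≤ Real.exp ((((k : ℝ) + 1) + δ) * n) * (Real.exp (δ * n) *
            (Real.exp (lm * ((2 * n * (k + 1) : ℕ) : ℝ)) *
              Real.exp (l2 * ((((k + 1) * ((m * (k + 1) + 3) * n)) : ℕ) : ℝ)) * Real.exp (L / mr * n))) := by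
          refine mul_le_mul hDle ?_ (by positivity) (Real.exp_pos _).le
          refine mul_le_mul hfact ?_ (by positivity) (Real.exp_pos _).le
          refine mul_le_mul ?_ (hMdiv n) (by positivity) (by positivity)
          rw [hmpow, h2pow]
      _ = Real.exp ((L / mr + cB + wr + 2 * δ) * n) := by
          rw [← Real.exp_add, ← Real.exp_add, ← Real.exp_add, ← Real.exp_add]
          congr 1
          rw [hcBdef, hwrk, hmrdef]
          push_cast
          ring

end ShiftPade

open ShiftPade in
/-- **Linear independence of `1` and the `Φ_{s,r}(1/M)` (`1 ≤ r ≤ m`, `1 ≤ s ≤ w`) over `ℚ`** for `m ≥ 2`, `w ≥ 1` and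
`log M ≥ 4 m³ (w+1)³`: every rational relation `a + ∑_{j<w} ∑_{r<m} b_{j,r} Φ_{j+1,r+1}(1/M) = 0` is trivial.
[cite: DavidHirataKohnoKawashima2020, Thm 2.1] -/
theorem one_lerchShift_linearIndependent (m w : ℕ) (hm : 2 ≤ m) (hw : 1 ≤ w) (M : ℕ)
    (hM : 4 * (m : ℝ) ^ 3 * ((w : ℝ) + 1) ^ 3 ≤ Real.log M) (a : ℚ) (b : Fin w → Fin m → ℚ)
    (h : (a : ℝ) + ∑ j : Fin w, ∑ r : Fin m, (b j r : ℝ) *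
      lerchShift m ((r : ℕ) + 1) ((j : ℕ) + 1) (1 / (M : ℝ)) = 0) :
    a = 0 ∧ b = 0 := by
  classical
  set d : ℕ := a.den * ∏ j, ∏ r, (b j r).den with hd
  have hdpos : 0 < d := Nat.mul_pos a.den_pos
    (Finset.prod_pos fun j _ => Finset.prod_pos fun r _ => (b j r).den_pos)
  have hclear : ∀ t : ℚ, t.den ∣ d → ∃ z : ℤ, (d : ℚ) * t = z := by
    intro t ht
    obtain ⟨c', hc'⟩ := ht
    refine ⟨(c' : ℤ) * t.num, ?_⟩
    have h1 : (d : ℚ) = (t.den : ℚ) * c' := by exact_mod_cast hc'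
    rw [h1, mul_comm (t.den : ℚ), mul_assoc, Rat.den_mul_eq_num]
    push_cast
    ring
  have hda : a.den ∣ d := Dvd.intro _ rfl
  have hdb : ∀ j r, (b j r).den ∣ d := fun j r =>
    ((Finset.dvd_prod_of_mem (fun r => (b j r).den) (mem_univ r)).trans
      (Finset.dvd_prod_of_mem (fun j => ∏ r, (b j r).den) (mem_univ j))).trans (Dvd.intro_left _ rfl)
  obtain ⟨a', ha'⟩ := hclear a hda
  choose b' hb' using fun j r => hclear (b j r) (hdb j r)
  have castR : ∀ (t : ℚ) (z : ℤ), (d : ℚ) * t = z → (z : ℝ) = (d : ℝ) * t := fun t z hz => by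
    have := congrArg (fun t : ℚ => (t : ℝ)) hz
    push_cast at this
    linarith
  have hrel : (a' : ℝ) + ∑ j : Fin w, ∑ r : Fin m, (b' j r : ℝ) *
      lerchShift m ((r : ℕ) + 1) ((j : ℕ) + 1) (1 / (M : ℝ)) = 0 := by
    have eb : ∑ j : Fin w, ∑ r : Fin m, (b' j r : ℝ) * lerchShift m ((r : ℕ) + 1) ((j : ℕ) + 1) (1 / (M : ℝ)) =
        (d : ℝ) * ∑ j : Fin w, ∑ r : Fin m, (b j r : ℝ) * lerchShift m ((r : ℕ) + 1) ((j : ℕ) + 1) (1 / (M : ℝ)) := by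
      rw [Finset.mul_sum]
      refine Finset.sum_congr rfl fun j _ => ?_
      rw [Finset.mul_sum]
      exact Finset.sum_congr rfl fun r _ => by rw [castR (b j r) (b' j r) (hb' j r)]; ring
    rw [castR a a' ha', eb]
    have := congrArg (fun t => (d : ℝ) * t) h
    simp only [mul_zero] at this
    linear_combination this
  obtain ⟨h0, h1⟩ := ShiftPade.intRelation_trivial_shift m w hm hw M hM a' b' hrel
  have hd0 : (d : ℚ) ≠ 0 := by exact_mod_cast hdpos.ne'
  refine ⟨?_, ?_⟩
  · have e' : (d : ℚ) * a = 0 := by rw [ha', h0]; simp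
    simpa [hd0] using e'
  · funext j r
    have e' : (d : ℚ) * b j r = 0 := by rw [hb' j r, congrFun (congrFun h1 j) r]; simp
    simpa [hd0] using e'

end Literature.NumberTheory.DiophantineApproximation
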